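import Summits.HubbardSuperconductivity.HubbardSuperconductivity.Theorems.AnisotropyChordTransferFibre3L2CellCover
import Summits.HubbardSuperconductivity.HubbardSuperconductivity.Theorems.AnisotropyChordTransferFibre3ManifoldA
import Summits.HubbardSuperconductivity.HubbardSuperconductivity.Theorems.AnisotropyChordTransferFibre3N1RowL2Cover

/-!
# Route `AnisotropyChord` / H0 rotor rung, LEVEL 2 (`∀ L ≥ 128`): locating `Δ ≤ Δ*` in the `(ν, a)` plane

For a ground two-magnon profile, `a = Δ·f(x̂)` and `η_eff = (1 − Δ)·f(x̂) = π²ν` (`ManifoldA.manifold_dictionary` (i), (vii)), hence the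
EXACT location identity ★ `a_mul_one_sub_delta`: `a·(1 − Δ) = Δ·π²·ν`, i.e. `Δ = a/(a + π²ν)`.  Consequently ★★ `a_le_of_delta_le`: if
`Δ ≤ D < 1` then `a ≤ D/(1 − D)·π²·ν` — the side condition `Δ ≤ Δ*` of the interim target (ruling R3: `Δ* = 0.98`, `D/(1−D) = 49`) removes
exactly the corner `ν < a(1 − Δ*)/(Δ*π²)` of the `(ν, a)` band (the `Δ → 1` strip: at `ν = 2.75·10⁻⁴` only `a ≤ 0.134` is needed, at
`ν = 10⁻³` only `a ≤ 0.48`), L-uniformly.  ★★ `gm3_of_closed_box_delta`: GM₃ for `(L, Δ)` with `0 < Δ ≤ D` from a box closed on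
`a ∈ [0, a_top]`, `a_top ≥ D/(1−D)·π²·ν₂`, and the `ν`-location of the profiles (`π² < 9.8697`).
Prover seat `hubbard-h0-rotor-p1` g31 (route lead); helper for piece A = stmt-HubbardSuperconductivity-23918 of rung 19089
(`--supports`, helper class).  Nothing here proves superconductivity in the Hubbard model; location lemmas for ONE conditional
reduction (the GM₃ ∀L certificate).  Tree imports only; no sorry.
-/

set_option linter.dupNamespace false
set_option autoImplicit false

namespace Summit.HubbardSuperconductivity.HubbardSuperconductivity.Theorems.AnisotropyChord.Transfer.Fibre3

namespace L2

variable (L : ℕ) [NeZero L]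

/-- ★ the location identity `a·(1 − Δ) = Δ·π²·ν` (`a = Δf(x̂)`, `(1 − Δ)f(x̂) = η_eff = π²ν`). [folklore] -/
theorem a_mul_one_sub_delta (hL : 5 ≤ L) {Δ lam2 : ℝ} (hΔ0 : 0 ≤ Δ) (hΔ1 : Δ < 1) {f : Tor L → ℝ}
    (hf : IsGroundTwoMagnon L Δ lam2 f) :
    Δ * f (K1 L) * (1 - Δ) = Δ * (Real.pi ^ 2 * (lam2 / (2 * Real.pi / L) ^ 2)) := by
  obtain ⟨d1, _, _, _, _, _, d7⟩ := ManifoldA.manifold_dictionary L hL hΔ0 hΔ1 hf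
  rw [← d7]
  linear_combination Δ * d1

/-- ★★ `Δ ≤ D < 1 ⟹ a ≤ D/(1 − D)·π²·ν`. [folklore] -/
theorem a_le_of_delta_le (hL : 5 ≤ L) {Δ lam2 : ℝ} (hΔ0 : 0 ≤ Δ) (hΔ1 : Δ < 1) {f : Tor L → ℝ}
    (hf : IsGroundTwoMagnon L Δ lam2 f) {D : ℝ} (hD : Δ ≤ D) (hD1 : D < 1) :
    Δ * f (K1 L) ≤ D / (1 - D) * (Real.pi ^ 2 * (lam2 / (2 * Real.pi / L) ^ 2)) := by
  have hid := a_mul_one_sub_delta L hL hΔ0 hΔ1 hf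
  set a := Δ * f (K1 L) with ha
  set E := Real.pi ^ 2 * (lam2 / (2 * Real.pi / L) ^ 2) with hE
  have hLpos : (0 : ℝ) < L := by exact_mod_cast (show 0 < L by omega)
  have hlam : 0 < lam2 := lam2_pos L (by omega) hΔ1 hf.1
  have hE0 : 0 ≤ E := by rw [hE]; positivity
  have h1 : 0 < 1 - Δ := by linarith
  have h2 : 0 < 1 - D := by linarith
  -- `a = ΔE/(1−Δ) ≤ DE/(1−D)`
  have ha' : a = Δ * E / (1 - Δ) := by rw [eq_div_iff h1.ne']; exact hid
  rw [ha', div_mul_eq_mul_div, div_le_div_iff₀ h1 h2]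
  nlinarith [mul_nonneg hE0 (sub_nonneg.2 hD), mul_nonneg hE0 hΔ0]

/-- ★★ **GM₃ for `0 < Δ ≤ D` from a box closed up to `a_top ≥ 49·π²ν₂`-type height**: if the closure statement holds on
`[ν₁, ν₂] × [0, a_top]`, the profiles of `(L, Δ)` have `ν ∈ [ν₁, ν₂]`, and `D/(1−D)·(98697/10000)·ν₂ ≤ a_top` (`π² < 9.8697`), then
`GM3Fibre L Δ` (`L ≥ 128`, `0 < Δ ≤ D < 1`). [folklore] -/
theorem gm3_of_closed_box_delta (hL : 128 ≤ L) {Δ D : ℝ} (hΔ0 : 0 < Δ) (hΔD : Δ ≤ D) (hD1 : D < 1) (n1 n2 atop : ℝ)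
    (hD0 : 0 ≤ D) (htop : D / (1 - D) * ((98697 : ℝ) / 10000 * n2) ≤ atop)
    (hclosed : ∀ lam2 : ℝ, ∀ f : Tor L → ℝ, IsGroundTwoMagnon L Δ lam2 f →
      n1 ≤ lam2 / (2 * Real.pi / L) ^ 2 → lam2 / (2 * Real.pi / L) ^ 2 ≤ n2 → 0 ≤ Δ * f (K1 L) → Δ * f (K1 L) ≤ atop →
        ∃ c a b : ℝ,
          (0 ≤ mHole L Δ f ∧ facMI L Δ f * etaEff L lam2 * (a + b / (2 + Real.cos (2 * Real.pi / L))) < c) ∧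
          c * Uunit L Δ f ≤ trialGapN1 L Δ f ∧
          lowGForm L Δ f ≤ a * etaEff L lam2 * Uunit L Δ f ∧
          (ip L (resid L Δ f) (resid L Δ f)).re - polePart L Δ f - lowNormPart L Δ f
            ≤ b * etaEff L lam2 * (2 * eps1 L - Tplus L Δ f) * Uunit L Δ f)
    (hν : ∀ lam2 : ℝ, ∀ f : Tor L → ℝ, IsGroundTwoMagnon L Δ lam2 f →
      n1 ≤ lam2 / (2 * Real.pi / L) ^ 2 ∧ lam2 / (2 * Real.pi / L) ^ 2 ≤ n2) :
    GM3Fibre L Δ := by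
  have hΔ1 : Δ < 1 := lt_of_le_of_lt hΔD hD1
  refine gm3_of_closed_box L hL hΔ0 hΔ1 n1 n2 0 atop hclosed ?_
  intro lam2 f hf
  obtain ⟨h1, h2⟩ := hν lam2 f hf
  obtain ⟨ha0, hν0, _⟩ := L2.N1.region_sides L hL hΔ0.le hΔ1 hf
  refine ⟨h1, h2, ha0, ?_⟩
  have hal := a_le_of_delta_le L (by omega) hΔ0.le hΔ1 hf hΔD hD1
  have hπ2 : Real.pi ^ 2 < (98697 : ℝ) / 10000 := by nlinarith [Real.pi_lt_d6, Real.pi_pos]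
  have hDD : 0 ≤ D / (1 - D) := div_nonneg hD0 (by linarith)
  have : Real.pi ^ 2 * (lam2 / (2 * Real.pi / L) ^ 2) ≤ (98697 : ℝ) / 10000 * n2 := by
    nlinarith [hν0, h2]
  exact hal.trans ((mul_le_mul_of_nonneg_left this hDD).trans htop)

end L2

end Summit.HubbardSuperconductivity.HubbardSuperconductivity.Theorems.AnisotropyChord.Transfer.Fibre3
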